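import Summits.BirchSwinnertonDyer.BirchSwinnertonDyer.Theses.ThetaPartnerAtTwo
import Summits.BirchSwinnertonDyer.BirchSwinnertonDyer.Theorems.ThetaPartnerAtTwoSignedMainConjectureCMTwoRankZeroOfPubOfFlatOfKZ
import HarnessLib

/-!
# Route `ThetaPartnerAtTwo` (TP2) — closer of the KZ-window child C2 `SignedMainConjectureCMTwoRankZeroOfPubOfFlatOfKZ`

HONEST FRAMING (cell `pub/bsd-wall`, W-ALL row 1 TP2 K2 column; width seat `bsd-tp2-w5` g0 under director-bsd (195)).
The route item C2 `SignedMainConjectureCMTwoRankZeroOfPubOfFlatOfKZ := KatoZetaErlKSideCMAtTwoSupply → SignedMainConjectureCMTwoRankZeroOfPubOfFlat`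
(the pen's KZ window on K2R0P♭ stmt-BirchSwinnertonDyer-26471) is closed BY NAME by the landed one-hypothesis certificate p638949
`SignedLowerOffTwo.signedMainConjectureCMTwoRankZeroOfPubOfFlat_of_zetaErlKSide` (lead tp2-p2 g11), whose displayed hypothesis is the HOLD item
C1 `KatoZetaErlKSideCMAtTwoSupply` (= registered stub `stub_zetaErlKSideCMTwo` of line `rankzero` v21 = crux workfile `KZHold.lean` `KZText`, verbatim).
Nothing here discharges C1 (a PUBLISHED INPUT: Kato 2004 Thm. 12.5 / §15 for the CM newform `f_A` at `p = 2`, Kobayashi 2003 (8.23),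
Johnson-Leung–Kings 2011 Thm. 5.7 §7.2); K2R0P♭ 26471 then reads «⟸ C1 (HOLD)» by the gate's split glue. BSD is NOT proved by any of this.
-/

set_option autoImplicit false
set_option linter.dupNamespace false

namespace Summit.BirchSwinnertonDyer.BirchSwinnertonDyer.Theorems

/-- **C2 BY NAME**: the route decl `SignedMainConjectureCMTwoRankZeroOfPubOfFlatOfKZ` (KZ supply → K2R0P♭) holds — one line over the landed
certificate p638949. CONDITIONAL on nothing beyond its own antecedent C1 (HOLD, published input).
[cite: Kato2004Asterisque, Thm. 12.5 (p. 222), Prop. 15.9, Lemma 15.13, (15.16.1) (pp. 258–265)] [cite: Kobayashi2003, (8.23), Thm. 7.3 (ii)]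
[cite: JohnsonLeungKings2011, Thm. 5.7 and §7.2] -/
theorem signedMainConjectureCMTwoRankZeroOfPubOfFlatOfKZ_proof :
    Summit.BirchSwinnertonDyer.BirchSwinnertonDyer.Theses.ThetaPartnerAtTwo.SignedMainConjectureCMTwoRankZeroOfPubOfFlatOfKZ := by
  unfold Summit.BirchSwinnertonDyer.BirchSwinnertonDyer.Theses.ThetaPartnerAtTwo.SignedMainConjectureCMTwoRankZeroOfPubOfFlatOfKZ
  intro hKZ
  exact SignedLowerOffTwo.signedMainConjectureCMTwoRankZeroOfPubOfFlat_of_zetaErlKSide hKZ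

end Summit.BirchSwinnertonDyer.BirchSwinnertonDyer.Theorems
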